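import Mathlib.RingTheory.LocalRing.MaximalIdeal.Basic
import Mathlib.RingTheory.Ideal.Operations
import Mathlib.Tactic.LinearCombination
import Mathlib.Tactic.Ring
import HarnessLib

/-!
# [OURS · L1 W4.5(b)] EL♮ helper H-COMB, part 4 — `comb_node_avoid`: the two charts of the blow-up along a
# comb at its node (tri-1's typable core, COMB-CHECK §−4.B (1))

Support file of the crux chain w45b (cell `res-hironaka`, LADDER-RESOLUTION rung L, slot W4.5(b)), working crux
**EL♮ = `EquisingularLiftNat`** (stmt-ResolutionOfSingularities-20038; bookkeeping node stmt-ResolutionOfSingularities-15660),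
research stub `stub_elnat_three(_horiz)` of line `sections`; kernel certificate of res-L1-w45b-tri-1's COMB-CHECK
computation TRIAGE v4 §−4.B (1) «COMB NODE AVOID ✓ (both charts)» = CRUX-PLAN v3 §1.7 (comb device, worked case
`H_F` points-first), named `comb_node_avoid` in CHAIN v7 §3 (row «H-COMB part 2», seat res-L1-w45b-stub-3).
OURS — elementary polynomial identities over an arbitrary commutative ring, in the style of
`Theorems/EquisingularLiftEquisingularLiftHauserCuspCharts.lean`; replaces the role of NOTHING in H. Hironaka's
manuscript and is NOT a statement of it. AI review is weaker than expert review.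

## The computation (tri-1, by hand; here kernel-checked)

Downstairs, near the node `d` of a comb `Z = e ∪ ℓ′` inside the carrier `V(E₁)` of the special fibre `P_{i,k}`
(local coordinates `E₁, X, t`; comb ideal `(E₁, X·t)`; `e = V(E₁, X)`, `ℓ′ = V(E₁, t)`), the current surface
has an equation of the shape `h = g·E₁² + f·E₁·X²t + X⁴t²` (multiplicity `2` along both teeth, `g` a unit at
`d`: EQUIMULTIPLE at the node). The blow-up of `P_{i,k}` along `(E₁, X·t)` has two charts:

* chart `E₁·T = X·t` (ambient the conifold `{E₁T = Xt}`, exceptional divisor `E₁ = 0`, vertex `b` = the BAD point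
  of the blown-up ambient over `d`): `h = E₁²·(g + f·X·T + X²·T²)` (`comb_node_chartT_total`), so the strict
  transform is `g + f·X·T + X²·T²`, whose value at `b` is `g(d) ≠ 0` — **`b ∉ St H`**
  (`comb_node_avoid`: in a local ring, `g` a unit and `X ∈ 𝔪` make the strict transform a unit); this is the
  AVOID statement M10 (`EquimultipleAlongTrace`, res-L1-w45b-stub-1 p501715) at a comb node;
* chart `E₁ = X·t·S` (smooth ambient `𝔸³_{X,t,S}`, exceptional divisor `X·t = 0`): `h = (X·t)²·(g·S² + f·X·S + X²)`
  (`comb_node_chartS_total`); the strict transform `g·S² + f·X·S + X²` lies in `(X, S)²`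
  (`comb_node_chartS_strict_mem_sq`): multiplicity `≥ 2` (an `A₁` double line in characteristic `2` as `f ≠ 0`,
  tri-1) along `Γ = V(X, S)`, the carrier-direction section over `e`, while `ℓ′` is resolved.

References (context): the identities are folklore chart computations; H. Hauser, Bull. AMS 47 (2010) for the
blow-up chart formalism; run/shared/lean/pub/res-hironaka/L/res-L1-w45b-tri-1/TRIAGE.md v4.1 §−4.B.
-/

-- single-problem summit: the doubled namespace component is forced
set_option linter.dupNamespace false

namespace Summit.ResolutionOfSingularities.ResolutionOfSingularities.Theorems.EquisingularLiftNat.CombCentre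

variable {R : Type*} [CommRing R]

/-- **Chart `E₁·T = X·t` of the blow-up along the comb ideal `(E₁, X·t)`, total transform**: on the chart
relation `X·t = E₁·T`, `g·E₁² + f·E₁·X²t + X⁴t² = E₁²·(g + f·X·T + X²·T²)` — exceptional factor `E₁²` times the
strict transform `g + f·X·T + X²·T²`. [folklore] -/
theorem comb_node_chartT_total (E₁ X t T g f : R) (hchart : X * t = E₁ * T) :
    g * E₁ ^ 2 + f * E₁ * X ^ 2 * t + X ^ 4 * t ^ 2 = E₁ ^ 2 * (g + f * X * T + X ^ 2 * T ^ 2) := by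
  have h1 : f * E₁ * X ^ 2 * t = E₁ ^ 2 * (f * X * T) := by
    linear_combination (f * E₁ * X) * hchart
  have h2 : X ^ 4 * t ^ 2 = E₁ ^ 2 * (X ^ 2 * T ^ 2) := by
    linear_combination (X ^ 2 * (X * t + E₁ * T)) * hchart
  rw [h1, h2]; ring

/-- **`comb_node_avoid`** (res-L1-w45b-tri-1 TRIAGE v4 §−4.B (1); CRUX-PLAN v3 §1.7): at the vertex `b` of the
conifold chart — the bad point over the comb node — the strict transform `g + f·X·T + X²·T²` is a UNIT of the
local ring as soon as `g` is a unit and `X` lies in the maximal ideal; hence `b ∉ St H`: blowing up a comb does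
NO DAMAGE at an equimultiple node. [folklore] -/
theorem comb_node_avoid [IsLocalRing R] (X T g f : R) (hg : IsUnit g)
    (hX : X ∈ IsLocalRing.maximalIdeal R) : IsUnit (g + f * X * T + X ^ 2 * T ^ 2) := by
  by_contra h
  have hm : g + f * X * T + X ^ 2 * T ^ 2 ∈ IsLocalRing.maximalIdeal R :=
    (IsLocalRing.mem_maximalIdeal _).mpr h
  have hX' : f * X * T + X ^ 2 * T ^ 2 ∈ IsLocalRing.maximalIdeal R := by
    have e : f * X * T + X ^ 2 * T ^ 2 = X * (f * T + X * T ^ 2) := by ring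
    rw [e]
    exact Ideal.mul_mem_right _ _ hX
  have hg' : g ∈ IsLocalRing.maximalIdeal R := by
    have e : g = (g + f * X * T + X ^ 2 * T ^ 2) - (f * X * T + X ^ 2 * T ^ 2) := by ring
    rw [e]
    exact Ideal.sub_mem _ hm hX'
  exact (IsLocalRing.mem_maximalIdeal _).mp hg' hg

/-- The strict transform of the conifold chart does not vanish at the vertex: modulo any proper ideal `I`
containing `X` (e.g. the maximal ideal of the vertex), `g + f·X·T + X²·T² ≡ g`. [folklore] -/
theorem comb_node_chartT_strict_mem_iff (X T g f : R) (I : Ideal R) (hX : X ∈ I) :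
    g + f * X * T + X ^ 2 * T ^ 2 ∈ I ↔ g ∈ I := by
  have hX' : f * X * T + X ^ 2 * T ^ 2 ∈ I := by
    have e : f * X * T + X ^ 2 * T ^ 2 = X * (f * T + X * T ^ 2) := by ring
    rw [e]
    exact Ideal.mul_mem_right _ _ hX
  constructor
  · intro h
    have e : g = (g + f * X * T + X ^ 2 * T ^ 2) - (f * X * T + X ^ 2 * T ^ 2) := by ring
    rw [e]
    exact Ideal.sub_mem _ h hX'
  · intro h
    have e : g + f * X * T + X ^ 2 * T ^ 2 = g + (f * X * T + X ^ 2 * T ^ 2) := by ring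
    rw [e]
    exact Ideal.add_mem _ h hX'

/-- **Chart `E₁ = X·t·S` of the blow-up along the comb ideal, total transform**: substituting `E₁ = X·t·S`,
`g·E₁² + f·E₁·X²t + X⁴t² = (X·t)²·(g·S² + f·X·S + X²)` — exceptional factor `(X·t)²` times the strict transform
`g·S² + f·X·S + X²`. [folklore] -/
theorem comb_node_chartS_total (E₁ X t S g f : R) (hchart : E₁ = X * t * S) :
    g * E₁ ^ 2 + f * E₁ * X ^ 2 * t + X ^ 4 * t ^ 2 = (X * t) ^ 2 * (g * S ^ 2 + f * X * S + X ^ 2) := by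
  rw [hchart]; ring

/-- In the smooth chart `𝔸³_{X,t,S}` the strict transform `g·S² + f·X·S + X²` lies in `(X, S)²`: it has
multiplicity `≥ 2` along the carrier-direction line `Γ = V(X, S)` over the tooth `e` (an `A₁` double line when
`f² − 4g` is a unit, e.g. in characteristic `2` with `f ≠ 0`), while it no longer involves `t`: the handle `ℓ′`
is resolved. [folklore] -/
theorem comb_node_chartS_strict_mem_sq (X S g f : R) :
    g * S ^ 2 + f * X * S + X ^ 2 ∈ (Ideal.span {X, S} : Ideal R) ^ 2 := by
  have hX : X ∈ Ideal.span ({X, S} : Set R) := Ideal.subset_span (by simp)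
  have hS : S ∈ Ideal.span ({X, S} : Set R) := Ideal.subset_span (by simp)
  have h1 : g * S ^ 2 ∈ (Ideal.span {X, S} : Ideal R) ^ 2 := by
    rw [pow_two, pow_two]
    exact Ideal.mul_mem_left _ _ (Ideal.mul_mem_mul hS hS)
  have h2 : f * X * S ∈ (Ideal.span {X, S} : Ideal R) ^ 2 := by
    rw [mul_assoc, pow_two]
    exact Ideal.mul_mem_left _ _ (Ideal.mul_mem_mul hX hS)
  have h3 : X ^ 2 ∈ (Ideal.span {X, S} : Ideal R) ^ 2 := Ideal.pow_mem_pow hX 2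
  exact Ideal.add_mem _ (Ideal.add_mem _ h1 h2) h3

/-- The comb equation itself lies in the square of the comb ideal `(E₁, X·t)`: the surface has multiplicity
`≥ 2` along BOTH teeth of the comb (the hypothesis «equimultiple along the comb» of CRUX-PLAN v3 §1.7 in its
weakest, ideal-theoretic form). [folklore] -/
theorem comb_node_eq_mem_sq (E₁ X t g f : R) :
    g * E₁ ^ 2 + f * E₁ * X ^ 2 * t + X ^ 4 * t ^ 2 ∈ (Ideal.span {E₁, X * t} : Ideal R) ^ 2 := by
  have hE : E₁ ∈ Ideal.span ({E₁, X * t} : Set R) := Ideal.subset_span (by simp)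
  have hXt : X * t ∈ Ideal.span ({E₁, X * t} : Set R) := Ideal.subset_span (by simp)
  have h1 : g * E₁ ^ 2 ∈ (Ideal.span {E₁, X * t} : Ideal R) ^ 2 :=
    Ideal.mul_mem_left _ _ (Ideal.pow_mem_pow hE 2)
  have h2 : f * E₁ * X ^ 2 * t ∈ (Ideal.span {E₁, X * t} : Ideal R) ^ 2 := by
    have e : f * E₁ * X ^ 2 * t = (f * X) * (E₁ * (X * t)) := by ring
    rw [e, pow_two]
    exact Ideal.mul_mem_left _ _ (Ideal.mul_mem_mul hE hXt)
  have h3 : X ^ 4 * t ^ 2 ∈ (Ideal.span {E₁, X * t} : Ideal R) ^ 2 := by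
    have e : X ^ 4 * t ^ 2 = X ^ 2 * (X * t) ^ 2 := by ring
    rw [e]
    exact Ideal.mul_mem_left _ _ (Ideal.pow_mem_pow hXt 2)
  exact Ideal.add_mem _ (Ideal.add_mem _ h1 h2) h3

end Summit.ResolutionOfSingularities.ResolutionOfSingularities.Theorems.EquisingularLiftNat.CombCentre
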